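import Summits.CriticalPhenomena.SAWScalingLimit.Theses.SAWRenewalTightness
import Literature.Probability.RandomPlanarGeometry.SAWParafermion
import Literature.Probability.RandomPlanarGeometry.ConformalRestrictionProofs
import Literature.Probability.RandomPlanarGeometry.CaratheodoryHalfPlaneProofs

/-!
# Toolkit for the negative lemmas of crux `SubseqIdentification` (stmt-CriticalPhenomena-0783)

Refuter (cdisprove cycle 1) support file for the shared crux
`Summit.CriticalPhenomena.SAWScalingLimit.Theses.SAWRenewalTightness.SubseqIdentification`:
* the critical SAW law between COINCIDENT endpoints is the Dirac mass at the trivial walk (`law_self`),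
  whose curve class is the constant class at `δ·w` (`curve_nil`), so its test integrals are evaluations
  (`integral_law_self`, `integral_law_of_eq`);
* `not_isSLELaw_dirac_of_endpoint_ne`: `¬ IsSLELaw κ D (dirac c)` for a class `c` with a wrong
  endpoint (from the in-tree `IsSLELaw.ae_endpoints` and `JordanDomain.mapsTo_boundaryExtension_holds`);
* an HONEST endpoint approximation of the unit disc `(𝔻; 1, -1)`: the disc's mesh graph is connected,
  so `Ω_δ = δℤ² ∩ 𝔻`, and `δ ↦ (⌈δ⁻¹⌉ - 1, 0) → 1`, `δ ↦ (-(⌈δ⁻¹⌉ - 1), 0) → -1` (`isEndpointApprox_std`;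
  re-hosting, as reusable lemmas, the `have`s of `Theorems/SAWParafermionTightRefutation`);
* `isEndpointApprox_congr`: `IsEndpointApprox` only sees the germ of `(a, b)` at `0⁺`.
Consumed by `Negative/EndpointLoadBearing.lean`.
-/

noncomputable section

open Literature.Probability.RandomPlanarGeometry Literature.Probability.RandomPlanarGeometry.SAW
  Literature.Probability.LatticeModels Literature.Probability.Percolation MeasureTheory Filter
  Topology Set
open scoped NNReal ENNReal BoundedContinuousFunction

namespace Summit.CriticalPhenomena.SAWScalingLimit.Theorems.SubseqIdentification.Negative


/-! ### Toolkit: the SAW law between coincident endpoints -/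

/-- The constant class starts at its point. [folklore] -/
theorem source_constClass (z : ℂ) : (CurveClass.mk (Curve.const z)).source = z := rfl

/-- The constant class ends at its point. [folklore] -/
theorem target_constClass (z : ℂ) : (CurveClass.mk (Curve.const z)).target = z := rfl

/-- The polyline of the trivial walk is the constant map. [folklore] -/
theorem toCurve_nil {G : SimpleGraph (Site 2)} (emb : Site 2 → ℂ) (w : Site 2) :
    (SimpleGraph.Walk.nil : G.Walk w w).toCurve emb = ContinuousMap.const _ (emb w) := by
  ext t
  rfl

/-- The curve class of the trivial SAW at `w` is the constant class at `δ·w`. [folklore] -/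
theorem curve_nil (Ω : Set ℂ) (δ : ℝ) (w : Site 2) :
    (DomainSAW.nil w : DomainSAW Ω δ w w).curve = CurveClass.mk (Curve.const (meshPoint δ w)) := by
  simp only [DomainSAW.curve, DomainSAW.nil, Curve.const, toCurve_nil]

/-- Between coincident endpoints the critical SAW measure is the Dirac mass at the trivial walk
(a closed self-avoiding walk is trivial, `DomainSAW.uniqueSelf`; its weight is `x_c^0 = 1`).
[folklore] -/
theorem weight_self (Ω : Set ℂ) (δ : ℝ) (w : Site 2) :
    weight Ω δ w w = Measure.dirac (DomainSAW.nil w) := by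
  rw [weight, Measure.sum_fintype, Fintype.sum_unique]
  change ENNReal.ofReal (criticalFugacity ^ (DomainSAW.nil w : DomainSAW Ω δ w w).length) •
    Measure.dirac (DomainSAW.nil w) = _
  simp

/-- Between coincident endpoints the critical SAW LAW is the Dirac mass at the trivial walk (no
normalisation issue: total weight `1`). [folklore] -/
theorem law_self (Ω : Set ℂ) (δ : ℝ) (w : Site 2) :
    law Ω δ w w = Measure.dirac (DomainSAW.nil w) := by
  rw [law, weight_self]
  simp

/-- Hence every test integral against the coincident-endpoint law is an evaluation at the
constant class. [folklore] -/
theorem integral_law_self (Ω : Set ℂ) (δ : ℝ) (w : Site 2) (f : CurveClass ℂ →ᵇ ℝ) :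
    ∫ γ, f γ.curve ∂(law Ω δ w w) = f (CurveClass.mk (Curve.const (meshPoint δ w))) := by
  rw [law_self, integral_dirac' _ _
    ((DomainSAW.measurable_of_top fun γ : DomainSAW Ω δ w w => f γ.curve).stronglyMeasurable),
    curve_nil]

/-- At the origin the constant class does not depend on the mesh: the curve class of the trivial SAW
at `0` is `[const 0]`. [folklore] -/
theorem curve_nil_zero (Ω : Set ℂ) (δ : ℝ) :
    (DomainSAW.nil 0 : DomainSAW Ω δ 0 0).curve = CurveClass.mk (Curve.const 0) := by
  have h0 : meshPoint δ (0 : Site 2) = 0 := Complex.ext (by simp) (by simp)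
  rw [curve_nil, h0]

/-- Test integrals against the SAW law from the origin to itself are evaluations at `[const 0]`, at
every mesh. [folklore] -/
theorem integral_law_zero (Ω : Set ℂ) (δ : ℝ) (f : CurveClass ℂ →ᵇ ℝ) :
    ∫ γ, f γ.curve ∂(law Ω δ 0 0) = f (CurveClass.mk (Curve.const 0)) := by
  have h0 : meshPoint δ (0 : Site 2) = 0 := Complex.ext (by simp) (by simp)
  rw [integral_law_self, h0]

/-- The marked points of the unit-disc Dobrushin domain `(𝔻; 1, -1)`: `a = 1` and `b = -1`.
[folklore] -/
theorem unitDisc_pt : DobrushinDomain.unitDisc.pt 0 = 1 ∧ DobrushinDomain.unitDisc.pt 1 = -1 := by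
  constructor
  · simp [MarkedDomain.pt, DobrushinDomain.unitDisc, JordanDomain.unitDisc, circleMap]
  · simp [MarkedDomain.pt, DobrushinDomain.unitDisc, JordanDomain.unitDisc, circleMap]
    rw [show (2 * (Real.pi : ℂ) * 2⁻¹ * Complex.I) = Real.pi * Complex.I by ring]
    exact Complex.exp_pi_mul_I

/-- A Dirac mass at a class with a wrong ENDPOINT (start `≠ a` or end `≠ b`) is not a chordal SLE law
of `(D; a, b)` (SLE curves run from `a` to `b` a.s.: in-tree `IsSLELaw.ae_endpoints`, Carathéodory
input `JordanDomain.mapsTo_boundaryExtension_holds`, both sorry-free). [folklore] -/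
theorem not_isSLELaw_dirac_of_endpoint_ne {κ : ℝ≥0} {D : DobrushinDomain} {c : CurveClass ℂ}
    (hc : c.source ≠ D.pt 0 ∨ c.target ≠ D.pt 1) : ¬ IsSLELaw κ D (Measure.dirac c) := by
  intro h
  have h1 := IsSLELaw.ae_endpoints JordanDomain.mapsTo_boundaryExtension_holds h
  rw [ae_dirac_eq] at h1
  obtain ⟨hs, ht, -⟩ := Filter.eventually_pure.1 h1
  exact hc.elim (fun hc => hc hs) (fun hc => hc ht)

/-- The standard mesh sequence `s n = 1/(n+1) → 0⁺`. [folklore] -/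
theorem tendsto_inv_succ_nhdsGT :
    Tendsto (fun n : ℕ => 1 / ((n : ℝ) + 1)) atTop (𝓝[>] (0 : ℝ)) :=
  tendsto_nhdsWithin_iff.2
    ⟨tendsto_one_div_add_atTop_nhds_zero_nat,
      Eventually.of_forall fun n => Set.mem_Ioi.2 (by positivity)⟩

/-! ### Toolkit: an honest endpoint approximation of the unit disc

Re-hosted (as reusable lemmas) from the `have`s of the in-tree refutation
`Theorems/SAWParafermionTightRefutation.lean`: the mesh graph of the disc is connected, so `Ω_δ` is
all of `δℤ² ∩ 𝔻`, and `stdA δ = (⌈δ⁻¹⌉ - 1, 0) → 1 = a`, `stdB δ = -stdA δ → -1 = b` is an endpoint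
approximation of `(𝔻; 1, -1)`. Used to build witnesses that are HONEST near `0⁺` and degenerate only
where the weakened hypothesis no longer looks. -/

/-- `|δ·x|² = δ² (x₀² + x₁²)`. [folklore] -/
theorem normSq_meshPoint (δ : ℝ) (x : Site 2) :
    Complex.normSq (meshPoint δ x) = δ ^ 2 * ((x 0 : ℝ) ^ 2 + (x 1 : ℝ) ^ 2) := by
  rw [Complex.normSq_apply, meshPoint_re, meshPoint_im]; ring

/-- A lattice point at least as close to the origin as a point of the disc lies in the disc. [folklore] -/
theorem mem_ball_of_sq_le {δ : ℝ} {x y : Site 2} (hx : meshPoint δ x ∈ Metric.ball (0 : ℂ) 1)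
    (h : (y 0 : ℝ) ^ 2 + (y 1 : ℝ) ^ 2 ≤ (x 0 : ℝ) ^ 2 + (x 1 : ℝ) ^ 2) :
    meshPoint δ y ∈ Metric.ball (0 : ℂ) 1 := by
  rw [Metric.mem_ball, dist_zero_right] at hx ⊢
  have hx2 : ‖meshPoint δ x‖ ^ 2 < 1 := by
    have := norm_nonneg (meshPoint δ x); nlinarith
  have hy2 : ‖meshPoint δ y‖ ^ 2 ≤ ‖meshPoint δ x‖ ^ 2 := by
    rw [Complex.sq_norm, Complex.sq_norm, normSq_meshPoint, normSq_meshPoint]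
    exact mul_le_mul_of_nonneg_left h (sq_nonneg δ)
  have hy1 : ‖meshPoint δ y‖ ^ 2 < 1 := hy2.trans_lt hx2
  nlinarith [norm_nonneg (meshPoint δ y)]

/-- One lattice step towards the origin, decreasing `|x₀| + |x₁|` and not increasing the norm.
[folklore] -/
theorem exists_step (x : Site 2) (hx : x ≠ 0) :
    ∃ y : Site 2, (zdGraph 2).Adj x y ∧
      (y 0 : ℝ) ^ 2 + (y 1 : ℝ) ^ 2 ≤ (x 0 : ℝ) ^ 2 + (x 1 : ℝ) ^ 2 ∧
      (y 0).natAbs + (y 1).natAbs < (x 0).natAbs + (x 1).natAbs := by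
  by_cases h0 : x 0 = 0
  · have h1 : x 1 ≠ 0 := by
      intro h1; apply hx; funext i; fin_cases i <;> simp [h0, h1]
    rcases lt_or_gt_of_ne h1 with hneg | hpos
    · refine ⟨x + Pi.single 1 1, (zdGraph_adj_iff _ _).2 ⟨1, Or.inl rfl⟩, ?_, ?_⟩
      · simp only [Pi.add_apply, Pi.single_eq_same, Pi.single_eq_of_ne (zero_ne_one), add_zero,
          Int.cast_add, Int.cast_one]
        have : (x 1 : ℝ) ≤ -1 := by exact_mod_cast Int.le_sub_one_of_lt hneg
        nlinarith
      · simp only [Pi.add_apply, Pi.single_eq_same, Pi.single_eq_of_ne (zero_ne_one), add_zero]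
        omega
    · refine ⟨x - Pi.single 1 1, (zdGraph_adj_iff _ _).2 ⟨1, Or.inr (by simp)⟩, ?_, ?_⟩
      · simp only [Pi.sub_apply, Pi.single_eq_same, Pi.single_eq_of_ne (zero_ne_one), sub_zero,
          Int.cast_sub, Int.cast_one]
        have : (1 : ℝ) ≤ x 1 := by exact_mod_cast hpos
        nlinarith
      · simp only [Pi.sub_apply, Pi.single_eq_same, Pi.single_eq_of_ne (zero_ne_one), sub_zero]
        omega
  · rcases lt_or_gt_of_ne h0 with hneg | hpos
    · refine ⟨x + Pi.single 0 1, (zdGraph_adj_iff _ _).2 ⟨0, Or.inl rfl⟩, ?_, ?_⟩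
      · simp only [Pi.add_apply, Pi.single_eq_same, Pi.single_eq_of_ne (one_ne_zero), add_zero,
          Int.cast_add, Int.cast_one]
        have : (x 0 : ℝ) ≤ -1 := by exact_mod_cast Int.le_sub_one_of_lt hneg
        nlinarith
      · simp only [Pi.add_apply, Pi.single_eq_same, Pi.single_eq_of_ne (one_ne_zero), add_zero]
        omega
    · refine ⟨x - Pi.single 0 1, (zdGraph_adj_iff _ _).2 ⟨0, Or.inr (by simp)⟩, ?_, ?_⟩
      · simp only [Pi.sub_apply, Pi.single_eq_same, Pi.single_eq_of_ne (one_ne_zero), sub_zero,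
          Int.cast_sub, Int.cast_one]
        have : (1 : ℝ) ≤ x 0 := by exact_mod_cast hpos
        nlinarith
      · simp only [Pi.sub_apply, Pi.single_eq_same, Pi.single_eq_of_ne (one_ne_zero), sub_zero]
        omega

/-- The origin is a mesh vertex of the disc at every mesh. [folklore] -/
theorem zero_mem_meshVertices_ball (δ : ℝ) :
    (0 : Site 2) ∈ meshVertices (Metric.ball (0 : ℂ) 1) δ := by
  have h0 : meshPoint δ (0 : Site 2) = 0 := Complex.ext (by simp) (by simp)
  simp [meshVertices, h0]

/-- Neighbouring lattice points of the disc are joined in its mesh graph (convexity). [folklore] -/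
theorem meshGraph_ball_adj {δ : ℝ} {x y : Site 2} (hxy : (zdGraph 2).Adj x y)
    (hx : meshPoint δ x ∈ Metric.ball (0 : ℂ) 1) (hy : meshPoint δ y ∈ Metric.ball (0 : ℂ) 1) :
    (meshGraph (Metric.ball (0 : ℂ) 1) δ).Adj x y :=
  meshGraph_adj_iff.2 ⟨hxy, ((convex_ball (0 : ℂ) 1).segment_subset hx hy).trans subset_closure⟩

/-- Every mesh vertex of the disc is joined to the origin inside the mesh vertex graph. [folklore] -/
theorem reachable_zero_ball (δ : ℝ) : ∀ (n : ℕ) (x : Site 2)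
    (hx : x ∈ meshVertices (Metric.ball (0 : ℂ) 1) δ), (x 0).natAbs + (x 1).natAbs = n →
    (meshVertexGraph (Metric.ball (0 : ℂ) 1) δ).Reachable ⟨x, hx⟩ ⟨0, zero_mem_meshVertices_ball δ⟩ := by
  intro n
  induction n using Nat.strong_induction_on with
  | _ n ih =>
    intro x hx hn
    by_cases h0 : x = 0
    · subst h0; rfl
    obtain ⟨y, hadj, hle, hlt⟩ := exists_step x h0
    have hy : y ∈ meshVertices (Metric.ball (0 : ℂ) 1) δ := mem_ball_of_sq_le hx hle
    have h1 : (meshVertexGraph (Metric.ball (0 : ℂ) 1) δ).Adj ⟨x, hx⟩ ⟨y, hy⟩ := by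
      simp only [SimpleGraph.comap_adj, Function.Embedding.subtype_apply]
      exact meshGraph_ball_adj hadj hx hy
    exact h1.reachable.trans (ih _ (hn ▸ hlt) y hy rfl)

/-- The mesh vertex graph of the unit disc is preconnected at every mesh. [folklore] -/
theorem meshVertexGraph_ball_preconnected (δ : ℝ) :
    (meshVertexGraph (Metric.ball (0 : ℂ) 1) δ).Preconnected := fun u v =>
  (reachable_zero_ball δ _ u.1 u.2 rfl).trans (reachable_zero_ball δ _ v.1 v.2 rfl).symm

/-- For the disc, `Ω_δ` is all of `δℤ² ∩ 𝔻` (one component only). [folklore] -/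
theorem mem_meshDomain_ball {δ : ℝ} {x : Site 2} (hx : x ∈ meshVertices (Metric.ball (0 : ℂ) 1) δ) :
    x ∈ meshDomain (Metric.ball (0 : ℂ) 1) δ := by
  have hsub := (meshVertexGraph_ball_preconnected δ).subsingleton_connectedComponent
  simp only [meshDomain, Set.mem_iUnion, Set.mem_image]
  refine ⟨(meshVertexGraph (Metric.ball (0 : ℂ) 1) δ).connectedComponentMk ⟨x, hx⟩,
    fun C' => ?_, ⟨x, hx⟩, ?_, rfl⟩
  · rw [Subsingleton.elim C'
      ((meshVertexGraph (Metric.ball (0 : ℂ) 1) δ).connectedComponentMk ⟨x, hx⟩)]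
  · rw [SimpleGraph.ConnectedComponent.mem_supp_iff]

/-- Any two lattice points of the disc are joined in `Ω_δ`. [folklore] -/
theorem reachable_ball {δ : ℝ} {x y : Site 2} (hx : meshPoint δ x ∈ Metric.ball (0 : ℂ) 1)
    (hy : meshPoint δ y ∈ Metric.ball (0 : ℂ) 1) :
    (discreteDomainGraph (Metric.ball (0 : ℂ) 1) δ).Reachable x y := by
  let hom : meshVertexGraph (Metric.ball (0 : ℂ) 1) δ →g
      discreteDomainGraph (Metric.ball (0 : ℂ) 1) δ :=
    { toFun := Subtype.val
      map_rel' := fun {u v} h =>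
        discreteDomainGraph_adj_iff.2 ⟨h, mem_meshDomain_ball u.2, mem_meshDomain_ball v.2⟩ }
  exact (meshVertexGraph_ball_preconnected δ ⟨x, hx⟩ ⟨y, hy⟩).map hom

/-- The mesh point of the honest left endpoint is the real number `δ (⌈δ⁻¹⌉ - 1)`. [folklore] -/
theorem meshPoint_stdA (δ : ℝ) :
    meshPoint δ ![⌈δ⁻¹⌉ - 1, 0] = ((δ * ((⌈δ⁻¹⌉ - 1 : ℤ) : ℝ) : ℝ) : ℂ) :=
  Complex.ext (by simp) (by simp)

/-- `1 - δ ≤ δ (⌈δ⁻¹⌉ - 1) < 1` for `δ > 0`. [folklore] -/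
theorem near_bounds {δ : ℝ} (hδ : 0 < δ) :
    1 - δ ≤ δ * ((⌈δ⁻¹⌉ - 1 : ℤ) : ℝ) ∧ δ * ((⌈δ⁻¹⌉ - 1 : ℤ) : ℝ) < 1 := by
  have h1 : ((⌈δ⁻¹⌉ - 1 : ℤ) : ℝ) < δ⁻¹ := by
    push_cast; linarith [Int.ceil_lt_add_one (δ⁻¹)]
  have h2 : δ⁻¹ - 1 ≤ ((⌈δ⁻¹⌉ - 1 : ℤ) : ℝ) := by
    push_cast; linarith [Int.le_ceil (δ⁻¹)]
  have hδinv : δ * δ⁻¹ = 1 := mul_inv_cancel₀ hδ.ne'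
  constructor
  · nlinarith
  · nlinarith

/-- The honest left endpoint `(⌈δ⁻¹⌉ - 1, 0)` lies in the disc for `0 < δ < 2`. [folklore] -/
theorem stdA_mem {δ : ℝ} (hδ : 0 < δ) (hδ2 : δ < 2) :
    meshPoint δ ![⌈δ⁻¹⌉ - 1, 0] ∈ Metric.ball (0 : ℂ) 1 := by
  rw [meshPoint_stdA, Metric.mem_ball, dist_zero_right, Complex.norm_real, Real.norm_eq_abs,
    abs_lt]
  obtain ⟨h1, h2⟩ := near_bounds hδ
  constructor <;> linarith

/-- The honest right endpoint is the reflection of the left one. [folklore] -/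
theorem meshPoint_stdB (δ : ℝ) :
    meshPoint δ ![-(⌈δ⁻¹⌉ - 1), 0] = -meshPoint δ ![⌈δ⁻¹⌉ - 1, 0] :=
  Complex.ext (by simp; ring) (by simp)

/-- The honest right endpoint `(-(⌈δ⁻¹⌉ - 1), 0)` lies in the disc for `0 < δ < 2`. [folklore] -/
theorem stdB_mem {δ : ℝ} (hδ : 0 < δ) (hδ2 : δ < 2) :
    meshPoint δ ![-(⌈δ⁻¹⌉ - 1), 0] ∈ Metric.ball (0 : ℂ) 1 := by
  rw [meshPoint_stdB, Metric.mem_ball, dist_zero_right, norm_neg, ← dist_zero_right,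
    ← Metric.mem_ball]
  exact stdA_mem hδ hδ2

/-- The honest left endpoint is within `δ` of `a = 1`. [folklore] -/
theorem dist_stdA_le {δ : ℝ} (hδ : 0 < δ) : dist (meshPoint δ ![⌈δ⁻¹⌉ - 1, 0]) 1 ≤ δ := by
  rw [meshPoint_stdA, ← Complex.ofReal_one, Complex.dist_eq, ← Complex.ofReal_sub,
    Complex.norm_real, Real.norm_eq_abs, abs_le]
  obtain ⟨h1, h2⟩ := near_bounds hδ
  constructor <;> linarith

/-- The honest right endpoint is within `δ` of `b = -1`. [folklore] -/
theorem dist_stdB_le {δ : ℝ} (hδ : 0 < δ) : dist (meshPoint δ ![-(⌈δ⁻¹⌉ - 1), 0]) (-1) ≤ δ := by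
  rw [meshPoint_stdB, dist_neg_neg]
  exact dist_stdA_le hδ

/-- `δ · stdA δ → 1 = a` along `δ → 0⁺`. [folklore] -/
theorem tendsto_meshPoint_stdA : Tendsto (fun δ => meshPoint δ ![⌈δ⁻¹⌉ - 1, 0]) (𝓝[>] (0 : ℝ)) (𝓝 1) := by
  rw [Metric.tendsto_nhds]
  intro ε hε
  filter_upwards [Ioo_mem_nhdsGT hε] with δ hδ
  exact (dist_stdA_le hδ.1).trans_lt hδ.2

/-- `δ · stdB δ → -1 = b` along `δ → 0⁺`. [folklore] -/
theorem tendsto_meshPoint_stdB :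
    Tendsto (fun δ => meshPoint δ ![-(⌈δ⁻¹⌉ - 1), 0]) (𝓝[>] (0 : ℝ)) (𝓝 (-1)) := by
  rw [Metric.tendsto_nhds]
  intro ε hε
  filter_upwards [Ioo_mem_nhdsGT hε] with δ hδ
  exact (dist_stdB_le hδ.1).trans_lt hδ.2

/-- `stdA, stdB` are joined in `Ω_δ` for `δ ∈ (0, 2)`. [folklore] -/
theorem reachable_stdA_stdB {δ : ℝ} (hδ : 0 < δ) (hδ2 : δ < 2) :
    (discreteDomainGraph DobrushinDomain.unitDisc.carrier δ).Reachable ![⌈δ⁻¹⌉ - 1, 0] ![-(⌈δ⁻¹⌉ - 1), 0] :=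
  reachable_ball (stdA_mem hδ hδ2) (stdB_mem hδ hδ2)

/-- **An honest endpoint approximation of `(𝔻; 1, -1)`** (non-vacuity of `IsEndpointApprox`, and
the raw material of the witnesses below). [folklore] -/
theorem isEndpointApprox_std : IsEndpointApprox DobrushinDomain.unitDisc (fun δ => ![⌈δ⁻¹⌉ - 1, 0]) (fun δ => ![-(⌈δ⁻¹⌉ - 1), 0]) := by
  refine ⟨?_, ?_, ?_⟩
  · filter_upwards [Ioo_mem_nhdsGT (by norm_num : (0 : ℝ) < 2)] with δ hδ
    exact reachable_stdA_stdB hδ.1 hδ.2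
  · rw [unitDisc_pt.1]; exact tendsto_meshPoint_stdA
  · rw [unitDisc_pt.2]; exact tendsto_meshPoint_stdB

/-- `IsEndpointApprox` only sees the germ of `(a, b)` at `0⁺`. [folklore] -/
theorem isEndpointApprox_congr {D : DobrushinDomain} {a b a' b' : ℝ → Site 2}
    (h : IsEndpointApprox D a b) (ha : a =ᶠ[𝓝[>] (0 : ℝ)] a') (hb : b =ᶠ[𝓝[>] (0 : ℝ)] b') :
    IsEndpointApprox D a' b' := by
  refine ⟨?_, ?_, ?_⟩
  · filter_upwards [h.reachable, ha, hb] with δ h1 h2 h3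
    rwa [← h2, ← h3]
  · exact h.tendsto_fst.congr' (ha.mono fun δ hδ => by rw [hδ])
  · exact h.tendsto_snd.congr' (hb.mono fun δ hδ => by rw [hδ])

/-- The test integrals between endpoints that are EQUAL (propositionally) to a common `w`
(dependent-type-friendly form of `integral_law_self`). [folklore] -/
theorem integral_law_of_eq {Ω : Set ℂ} {δ : ℝ} {u v w : Site 2} (hu : u = w) (hv : v = w)
    (f : CurveClass ℂ →ᵇ ℝ) :
    ∫ γ, f γ.curve ∂(law Ω δ u v) = f (CurveClass.mk (Curve.const (meshPoint δ w))) := by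
  subst hu hv; exact integral_law_self _ _ _ f

/-- … and when that common endpoint is the origin, the value does not depend on the mesh.
[folklore] -/
theorem integral_law_of_eq_zero {Ω : Set ℂ} {δ : ℝ} {u v : Site 2} (hu : u = 0) (hv : v = 0)
    (f : CurveClass ℂ →ᵇ ℝ) :
    ∫ γ, f γ.curve ∂(law Ω δ u v) = f (CurveClass.mk (Curve.const 0)) := by
  subst hu hv; exact integral_law_zero _ _ f

/-- `z ↦ [const z]` is `1`-Lipschitz (constant curves are as far apart as their points). [folklore] -/
theorem lipschitzWith_constClass : LipschitzWith 1 fun z : ℂ => CurveClass.mk (Curve.const z) := by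
  refine LipschitzWith.mk_one fun z z' => ?_
  rw [CurveClass.dist_mk_mk]
  refine (Curve.dist_le_dist_toContinuousMap _ _).trans ?_
  refine (ContinuousMap.dist_le dist_nonneg).2 fun t => ?_
  simp [Curve.const]

/-- `z ↦ [const z]` is continuous. [folklore] -/
theorem continuous_constClass : Continuous fun z : ℂ => CurveClass.mk (Curve.const z) :=
  lipschitzWith_constClass.continuous

end Summit.CriticalPhenomena.SAWScalingLimit.Theorems.SubseqIdentification.Negative
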